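import Literature.MathematicalPhysics.QuantumFieldTheory.Balaban1983to89.FlowStepRuns

/-!
# Spine estimate NE7 — THE TAIL GRADE SUPPLIES THE FLOW WINDOW FROM A CUTOFF ON, LITERALLY (seat ne7, file 24)

HONEST FRAMING (page 1): bookkeeping over tree theorems on ONE fixed finite torus T⁴ (rung (B)+1 of the cell's ladder);
NE7 is NOT proved (spine 0/9); NOT infinite volume, NOT a mass gap, NOT Clay; nothing of Bałaban's is asserted — the
β-functions, their eventual floor, their absolute bounds and the RG equations (0.20) are HYPOTHESIS BINDERS.  [folklore]
throughout; NO definitions; no cite tags (page numbers are LOCATORS).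

WHY (cell `pub-balaban-gaps`, seat ne7 gen 7, files 21–24).  File 23 re-keys route 1's docked END to the LITERAL two-sided
flow window (0.31) of [Balaban1987RG1] p. 259 (tree `Step.Discrete031 b β' K g gs`: `1/g² + b(K−k) ≤ 1/g_k² ≤ 1/g² +
β'(K−k)`, `k ≤ K`) asked at cutoffs `K ≥ K₁` only; file 21 §6 supplies the ANCHOR-FREE LOWER running from the TAIL grade.
This file closes the gap between the two shapes: along runs solving (0.20) with prefixes in the box, an EVENTUAL floor
`b ≤ β_k` (indices `k ≥ k₀`) together with the printed ABSOLUTE bounds `−β′ ≤ β_k ≤ β″` on the boxes gives the LITERAL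
two-sided window, pinned at the run's own final coupling, with slopes `(b/2, β″)`, at EVERY cutoff `K` with
`(3b + 2β′)k₀ ≤ bK` — the lower half is the tree's `FlowStepRuns.discrete031H_lower_of_eventualLower_largeK` (ITS anchor
kept this time), the upper half is the telescoped (0.20) against `β_k ≤ β″` (`discrete031H_upper_of_boxUpper`).  The
family form `eventually031_of_eventualFloor` is LITERALLY the binder `h031A` of
`SlotBetaKeyingRoute1.goodClause_summable_of_route1_docked_eventually031` (with `gf K := gs K K`, `bβ := b/2`), and of
`SlotBetaKeying.hybridNE7_of_slotDom_twoRate_crossover_eventually031` ∕ `summable_rRadius[_poly]_of_eventually031`.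
READING: route 1's END and the NE7 slot, as re-keyed in files 21–23, are fed END TO END by the TAIL grade + absolute
bounds; no β-value of index `< k₀` enters except through the absolute bounds.  NOT here: any producer of the floor or of
the bounds (the β sub-cell's roads, rows CAP ∕ tail of the cell's ledger).

Reference (LOCATOR only): [Balaban1987RG1] T. Bałaban, Commun. Math. Phys. 109 (1987) 249–301, (0.31) p. 259, (0.20) p. 256.
-/

namespace Summit.QuantumFields.BalabanUV.T4Continuum.Spine.NE7.SlotBetaKeyingTail

open Finset
open Literature.MathematicalPhysics.QuantumFieldTheory.Balaban1983to89
open Literature.MathematicalPhysics.QuantumFieldTheory.Balaban1983to89.FlowStep (HBeta RGEqH prefixOf Box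
  inv_sq_telescopeH)

/-- **THE UPPER HALF OF (0.31) FROM THE PRINTED UPPER BOUND.**  Along a solution of (0.20) up to cutoff `K` whose prefixes
lie in the box, `β_k ≤ β″` on the boxes gives `1/g_k² ≤ 1/g_K² + β″(K−k)` for `k ≤ K` (telescoped (0.20)). [folklore] -/
theorem discrete031H_upper_of_boxUpper {β : HBeta} {K : ℕ} {gs : ℕ → ℝ} {γ₀ β'' : ℝ} (hrg : RGEqH K β gs)
    (hbox : ∀ j, j < K → prefixOf gs j ∈ Box γ₀ j) (hup : ∀ k, ∀ v ∈ Box γ₀ k, β k v ≤ β'') :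
    ∀ k, k ≤ K → 1 / (gs k) ^ 2 ≤ 1 / (gs K) ^ 2 + β'' * ((K : ℝ) - k) := by
  intro k hk
  have ht := inv_sq_telescopeH hrg hk le_rfl
  have hcard : ((Finset.Ico k K).card : ℝ) = (K : ℝ) - k := by
    rw [Nat.card_Ico, Nat.cast_sub hk]
  have hsum : ∑ j ∈ Finset.Ico k K, β j (prefixOf gs j) ≤ β'' * ((K : ℝ) - k) := by
    rw [← hcard]
    have h := Finset.sum_le_card_nsmul (Finset.Ico k K) (fun j => β j (prefixOf gs j)) β''
      (fun j hj => hup j _ (hbox j (Finset.mem_Ico.mp hj).2))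
    rw [nsmul_eq_mul] at h
    linarith
  linarith

/-- **THE LITERAL WINDOW AT ONE LARGE CUTOFF FROM THE TAIL GRADE.**  Along a solution of (0.20) up to cutoff `K` with
prefixes in the box: an EVENTUAL floor `b ≤ β_k` on the boxes from index `k₀` on, the absolute bounds `−β′ ≤ β_k ≤ β″`
on the boxes, `0 ≤ b`, `0 ≤ β′` and `(3b + 2β′)k₀ ≤ bK` give the literal two-sided window (0.31) at cutoff `K`, pinned at
the run's own `g_K`, with slopes `(b/2, β″)`: `Step.Discrete031 (b/2) β″ K (gs K) gs`.  Lower half =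
`FlowStepRuns.discrete031H_lower_of_eventualLower_largeK`; upper half = `discrete031H_upper_of_boxUpper`. [folklore] -/
theorem discrete031H_of_eventualFloor_largeK {β : HBeta} {K : ℕ} {gs : ℕ → ℝ} {γ₀ b β' β'' : ℝ} {k₀ : ℕ}
    (hb : 0 ≤ b) (hβ' : 0 ≤ β') (hrg : RGEqH K β gs) (hbox : ∀ j, j < K → prefixOf gs j ∈ Box γ₀ j)
    (htail : ∀ k, k₀ ≤ k → ∀ v ∈ Box γ₀ k, b ≤ β k v) (hlo : ∀ k, ∀ v ∈ Box γ₀ k, -β' ≤ β k v)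
    (hup : ∀ k, ∀ v ∈ Box γ₀ k, β k v ≤ β'') (hK : (3 * b + 2 * β') * k₀ ≤ b * K) :
    Step.Discrete031 (b / 2) β'' K (gs K) gs := fun k hk =>
  ⟨FlowStepRuns.discrete031H_lower_of_eventualLower_largeK hb hβ' hrg hbox htail hlo hK k hk,
    discrete031H_upper_of_boxUpper hrg hbox hup k hk⟩

/-- **THE FAMILY FORM = THE RE-KEYED END's BINDER.**  For a family of runs `gs K` (one per cutoff) solving (0.20) with
prefixes in the box, the eventual floor from `k₀`, the absolute bounds and `(3b + 2β′)k₀ ≤ bK₀`: the literal window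
holds at EVERY cutoff `K ≥ K₀` — LITERALLY the hypothesis `h031A` (resp. `h031B`) of
`SlotBetaKeyingRoute1.goodClause_summable_of_route1_docked_eventually031` with `gf K := gs K K`, `bβ := b/2`, and the `h031`
of `SlotBetaKeying.hybridNE7_of_slotDom_twoRate_crossover_eventually031`.  No β-value of index `< k₀` is used except
through the absolute bounds. [folklore] -/
theorem eventually031_of_eventualFloor {β : HBeta} {gs : ℕ → ℕ → ℝ} {γ₀ b β' β'' : ℝ} {k₀ K₀ : ℕ}
    (hb : 0 ≤ b) (hβ' : 0 ≤ β') (hrg : ∀ K, RGEqH K β (gs K))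
    (hbox : ∀ K j, j < K → prefixOf (gs K) j ∈ Box γ₀ j)
    (htail : ∀ k, k₀ ≤ k → ∀ v ∈ Box γ₀ k, b ≤ β k v) (hlo : ∀ k, ∀ v ∈ Box γ₀ k, -β' ≤ β k v)
    (hup : ∀ k, ∀ v ∈ Box γ₀ k, β k v ≤ β'') (hK₀ : (3 * b + 2 * β') * k₀ ≤ b * K₀) :
    ∀ K, K₀ ≤ K → Step.Discrete031 (b / 2) β'' K (gs K K) (gs K) := fun K hK =>
  discrete031H_of_eventualFloor_largeK hb hβ' (hrg K) (hbox K) htail hlo hup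
    (hK₀.trans (mul_le_mul_of_nonneg_left (by exact_mod_cast hK) hb))

/-- Nonnegativity of the tables (the END's `hgsA`∕`hgsB`, file 21's `hgs`) from the coupling box: runs with
`0 < gs K i ≤ γ` for `i ≤ K`. [folklore] -/
theorem tables_nonneg_of_box {gs : ℕ → ℕ → ℝ} {γ : ℝ} (hbox : ∀ K i, i ≤ K → 0 < gs K i ∧ gs K i ≤ γ) :
    ∀ K k, k ≤ K → 0 ≤ gs K k := fun K k hk => (hbox K k hk).1.le

/-! The threshold is not idle: with an eventual floor from `k₀ = 1` only, the one-step table `g_0 = 2`, `g_1 = g = 1`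
violates the window at cutoff `K = 1` for every nonnegative lower slope — `SlotBetaKeying.keyed_fails_at_one` (file 21);
from `K ≥ (3 + 2β′/b)k₀` on the window holds by `discrete031H_of_eventualFloor_largeK`. -/

end Summit.QuantumFields.BalabanUV.T4Continuum.Spine.NE7.SlotBetaKeyingTail
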